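import Mathlib
import Summits.Ventures.PercRepro2.CrossAPrimeVMarkedVdBK
import Summits.Ventures.PercRepro2.CrossAPrimeVMarkedCut
import Summits.Ventures.PercRepro2.CutVertexDefs

/-!
# The v-marked vdB–Kahn inequality across a cut vertex at a MARK
(blind cell PercRepro2, p5 g41; S4 §2.4 (s) addendum 59)

`VMarkedVdBK p ends a₁ v o b` (CrossAPrimeVMarkedVdBK.lean; the candidate (★₂′) of row 2′VMARK) is
`P(R_o)·P(R_b ∩ L) + P(R_b)·P(R_o ∩ L) ≤ P(L)·P(R_{o,b}) + P(R_{o,b} ∩ L)` for the cluster `A` of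
`a₁`, `R_x = {x ∉ A}`, `L = {v ∈ A}`.  g40's `CrossAPrimeVMarkedCut.lean` settles it (with equality)
when the ROOT `a₁` is a cut vertex separating `o` from `b`.  This file settles it when a cut vertex
sits at one of the other three marks, or at the root with `v` alone on one side — every placement
of the remaining marks:

* `vMarkedVdBK_of_cut_v_far` — `v` a cut vertex, `a₁` on one side, `o` and `b` on the other
  (slack `ℓ·[(1+ℓ)·m₁₁ − 2ℓ·o·β] ≥ ℓ·o·β·(1−ℓ)` with `m₁₁ = P_B(v ↔ o, v ↔ b) ≥ o·β` by Harris);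
* `vMarkedVdBK_of_cut_v_near` — `v` a cut vertex, `a₁, b` on one side, `o` on the other
  (slack `P_B(v ↔ o)·[P_A(L)·P_A(R_b) − P_A(L ∩ R_b)] ≥ 0`, Harris in the mixed form);
* `vMarkedVdBK_of_cut_o_near` — `o` a cut vertex separating `a₁, v` from `b`
  (slack `P_B(o ↔ b)·[c(1 − o) + o(ℓ − c)]`, `c = P_A(a₁ ↔ o, a₁ ↔ v)`; no correlation input);
* `vMarkedVdBK_of_cut_o_far` — `o` a cut vertex separating `a₁` from `v, b`
  (slack `o(1 − o)·P_B(o ↔ v, o ↔ b)`);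
* `vMarkedVdBK_of_cut_o_mid` — `o` a cut vertex separating `a₁, b` from `v`
  (slack `P_B(o ↔ v)·[P_A(a₁ ↔ o)·P_A(R_b) − P_A(a₁ ↔ o, R_b)] ≥ 0`, Harris mixed);
* `vMarkedVdBK_of_cut_root_v` — `a₁` a cut vertex separating `v` from `o, b`
  (slack `2ℓ·[P_B(R_{o,b}) − P_B(R_o)·P_B(R_b)] ≥ 0`, Harris for decreasing events);
* the mirrors with `b` as the cut vertex (`vMarkedVdBK_comm`).

Together with g40's file: **(★₂′) holds whenever some mark is a cut vertex separating `a₁` from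
another mark, or `a₁` is a cut vertex separating two of the marks** — the open class of row 2′VMARK
is the «mark-2-connected» one.  Tools: the path lemma and product law of `CutVertexDefs.lean`
(`connEvent_eq_sideEvent`, `connEvent_across_eq`, `prob_sideEvent_inter_eq_mul`), Harris–FKG
(`Harris.lean`).  Own work; standard axioms.
-/

namespace Summit.Ventures.PercRepro2

open CutV CrossAPrimeVMarked CrossAPrimeVMarkedCut

namespace CrossAPrimeVMarkedCutMark

variable {V : Type*} {E : Type*} [Fintype E] [DecidableEq E] [Fintype V] [DecidableEq V]
  {R : Type*} [Field R] [LinearOrder R] [IsStrictOrderedRing R]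
variable {ends : E → Sym2 V} {x : V} {VA VB : Set V} {EA EB : Set E}

section Tools

omit [Fintype E] [DecidableEq E] [Fintype V] [DecidableEq V] in
/-- `restrict F` is monotone. -/
lemma restrict_mono_cm (F : Set E) [DecidablePred (· ∈ F)] {ω ω' : Config E} (h : ω ≤ ω') :
    restrict F ω ≤ restrict F ω' := by
  intro e
  by_cases he : e ∈ F
  · rw [restrict_apply_of_mem he, restrict_apply_of_mem he]
    exact h e
  · rw [restrict_apply_of_notMem he, restrict_apply_of_notMem he]

omit [Fintype E] [DecidableEq E] [Fintype V] [DecidableEq V] in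
/-- A side event of an increasing event is increasing. -/
lemma isUpperSet_sideEvent_cm (F : Set E) [DecidablePred (· ∈ F)] {A : Set (Config E)}
    (hA : IsUpperSet A) : IsUpperSet (sideEvent F A) :=
  fun _ _ hle hω => hA (restrict_mono_cm F hle) hω

omit [Fintype V] [DecidableEq V] [LinearOrder R] [IsStrictOrderedRing R] in
/-- `P(A ∩ Bᶜ) = P(A) − P(A ∩ B)`. -/
lemma prob_inter_compl_eq (p : E → R) (A B : Set (Config E)) :
    prob p (A ∩ Bᶜ) = prob p A - prob p (A ∩ B) := by
  have := prob_inter_add_prob_inter_compl p A B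
  linear_combination this

omit [Fintype V] [DecidableEq V] [LinearOrder R] [IsStrictOrderedRing R] in
/-- `P(A ∪ B) = P(A) + P(B) − P(A ∩ B)`. -/
lemma prob_union_eq (p : E → R) (A B : Set (Config E)) :
    prob p (A ∪ B) = prob p A + prob p B - prob p (A ∩ B) := by
  have := prob_union_add_prob_inter p A B
  linear_combination this

end Tools

section CutV

variable [DecidablePred (· ∈ EA)] [DecidablePred (· ∈ EB)]

omit [Fintype V] in
/-- **(★₂′) when `v` is a cut vertex with `a₁` on one side and `o`, `b` on the other.**  With
`ℓ = P_A(a₁ ↔ v)`, `o = P_B(v ↔ o)`, `β = P_B(v ↔ b)`, `m = P_B(v ↔ o, v ↔ b)`: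
`RHS − LHS = ℓ·[(1 + ℓ)·m − 2ℓ·o·β] ≥ ℓ·o·β·(1 − ℓ)` by Harris (`m ≥ o·β`). -/
theorem vMarkedVdBK_of_cut_v_far {p : E → R} (hp : IsProbVec p) (h : IsCut ends x VA VB EA EB)
    {a₁ o b : V} (ha : a₁ ∈ VA) (ho : o ∈ VB) (hb : b ∈ VB) : VMarkedVdBK p ends a₁ x o b := by
  unfold VMarkedVdBK
  have eL : connEvent ends a₁ x = sideEvent EA (connEvent ends a₁ x) :=
    connEvent_eq_sideEvent h (Set.mem_union_left _ ha) (Set.mem_union_right _ (Set.mem_singleton x))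
  have eo : connEvent ends a₁ o =
      sideEvent EA (connEvent ends a₁ x) ∩ sideEvent EB (connEvent ends x o) :=
    connEvent_across_eq h ha ho
  have eb : connEvent ends a₁ b =
      sideEvent EA (connEvent ends a₁ x) ∩ sideEvent EB (connEvent ends x b) :=
    connEvent_across_eq h ha hb
  rw [avoidAll_pair, avoidAll_singleton, avoidAll_singleton, eL, eo, eb]
  set L := sideEvent EA (connEvent ends a₁ x) with hL
  set O := sideEvent EB (connEvent ends x o) with hO
  set B := sideEvent EB (connEvent ends x b) with hB
  -- product law
  have hLO : prob p (L ∩ O) = prob p L * prob p O := prob_sideEvent_inter_eq_mul p h _ _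
  have hLB : prob p (L ∩ B) = prob p L * prob p B := prob_sideEvent_inter_eq_mul p h _ _
  have hLOB : prob p (L ∩ (O ∩ B)) = prob p L * prob p (O ∩ B) := by
    rw [hO, hB, ← sideEvent_inter]
    exact prob_sideEvent_inter_eq_mul p h _ _
  -- Harris on the `B`-side
  have hH : prob p O * prob p B ≤ prob p (O ∩ B) :=
    prob_mul_prob_le_prob_inter hp (isUpperSet_sideEvent_cm EB (isUpperSet_connEvent ends x o))
      (isUpperSet_sideEvent_cm EB (isUpperSet_connEvent ends x b))
  have hl0 := prob_nonneg hp L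
  have hl1 := prob_le_one hp L
  have ho0 := prob_nonneg hp O
  have hb0 := prob_nonneg hp B
  -- the seven masses
  have e1 : prob p (L ∩ O)ᶜ = 1 - prob p L * prob p O := by rw [prob_compl, hLO]
  have e3 : prob p (L ∩ B)ᶜ = 1 - prob p L * prob p B := by rw [prob_compl, hLB]
  have e2 : prob p ((L ∩ B)ᶜ ∩ L) = prob p L - prob p L * prob p B := by
    rw [Set.inter_comm, prob_inter_compl_eq, Set.inter_eq_right.2 Set.inter_subset_left, hLB]
  have e4 : prob p ((L ∩ O)ᶜ ∩ L) = prob p L - prob p L * prob p O := by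
    rw [Set.inter_comm, prob_inter_compl_eq, Set.inter_eq_right.2 Set.inter_subset_left, hLO]
  have eU : (L ∩ O) ∩ (L ∩ B) = L ∩ (O ∩ B) := by
    ext ω; simp only [Set.mem_inter_iff]; tauto
  have hU : prob p ((L ∩ O) ∪ (L ∩ B)) =
      prob p L * prob p O + prob p L * prob p B - prob p L * prob p (O ∩ B) := by
    rw [prob_union_eq, eU, hLO, hLB, hLOB]
  have e5 : prob p ((L ∩ O)ᶜ ∩ (L ∩ B)ᶜ) =
      1 - (prob p L * prob p O + prob p L * prob p B - prob p L * prob p (O ∩ B)) := by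
    rw [← Set.compl_union, prob_compl, hU]
  have e6 : prob p ((L ∩ O)ᶜ ∩ (L ∩ B)ᶜ ∩ L) =
      prob p L - (prob p L * prob p O + prob p L * prob p B - prob p L * prob p (O ∩ B)) := by
    rw [← Set.compl_union, Set.inter_comm, prob_inter_compl_eq,
      Set.inter_eq_right.2 (Set.union_subset Set.inter_subset_left Set.inter_subset_left), hU]
  rw [e1, e2, e3, e4, e5, e6]
  nlinarith [mul_nonneg (mul_nonneg hl0 (add_nonneg zero_le_one hl0)) (sub_nonneg.2 hH),
    mul_nonneg (mul_nonneg (mul_nonneg hl0 ho0) hb0) (sub_nonneg.2 hl1)]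

omit [Fintype V] in
/-- **(★₂′) when `v` is a cut vertex with `a₁`, `b` on one side and `o` on the other.**  With
`L = {a₁ ↔ v}`, `R_b` read on the `A`-side and `o = P_B(v ↔ o)`:
`RHS − LHS = o·[P_A(L)·P_A(R_b) − P_A(L ∩ R_b)] ≥ 0` (Harris, mixed form). -/
theorem vMarkedVdBK_of_cut_v_near {p : E → R} (hp : IsProbVec p) (h : IsCut ends x VA VB EA EB)
    {a₁ o b : V} (ha : a₁ ∈ VA) (ho : o ∈ VB) (hb : b ∈ VA) : VMarkedVdBK p ends a₁ x o b := by
  unfold VMarkedVdBK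
  have eL : connEvent ends a₁ x = sideEvent EA (connEvent ends a₁ x) :=
    connEvent_eq_sideEvent h (Set.mem_union_left _ ha) (Set.mem_union_right _ (Set.mem_singleton x))
  have eo : connEvent ends a₁ o =
      sideEvent EA (connEvent ends a₁ x) ∩ sideEvent EB (connEvent ends x o) :=
    connEvent_across_eq h ha ho
  have eb : connEvent ends a₁ b = sideEvent EA (connEvent ends a₁ b) :=
    connEvent_eq_sideEvent h (Set.mem_union_left _ ha) (Set.mem_union_left _ hb)
  rw [avoidAll_pair, avoidAll_singleton, avoidAll_singleton, eL, eo, eb]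
  set L := sideEvent EA (connEvent ends a₁ x) with hL
  set O := sideEvent EB (connEvent ends x o) with hO
  set Bv := sideEvent EA (connEvent ends a₁ b) with hBv
  have hLO : prob p (L ∩ O) = prob p L * prob p O := prob_sideEvent_inter_eq_mul p h _ _
  have hLBO : prob p ((L ∩ Bvᶜ) ∩ O) = prob p (L ∩ Bvᶜ) * prob p O := by
    rw [hL, hBv, ← sideEvent_compl, ← sideEvent_inter]
    exact prob_sideEvent_inter_eq_mul p h _ _
  -- Harris, mixed form, on the `A`-side
  have hH : prob p (L ∩ Bvᶜ) ≤ prob p L * prob p Bvᶜ := by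
    rw [Set.inter_comm, mul_comm]
    exact prob_inter_le_prob_mul_prob_of_isLowerSet hp
      (isUpperSet_sideEvent_cm EA (isUpperSet_connEvent ends a₁ b)).compl
      (isUpperSet_sideEvent_cm EA (isUpperSet_connEvent ends a₁ x))
  have ho0 := prob_nonneg hp O
  have e1 : prob p (L ∩ O)ᶜ = 1 - prob p L * prob p O := by rw [prob_compl, hLO]
  have e2 : prob p (Bvᶜ ∩ L) = prob p (L ∩ Bvᶜ) := by rw [Set.inter_comm]
  have e3 : prob p Bvᶜ = 1 - prob p Bv := prob_compl p Bv
  have e4 : prob p ((L ∩ O)ᶜ ∩ L) = prob p L - prob p L * prob p O := by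
    rw [Set.inter_comm, prob_inter_compl_eq, Set.inter_eq_right.2 Set.inter_subset_left, hLO]
  have e5 : prob p ((L ∩ O)ᶜ ∩ Bvᶜ) = prob p Bvᶜ - prob p (L ∩ Bvᶜ) * prob p O := by
    rw [Set.inter_comm, prob_inter_compl_eq, ← hLBO]
    congr 2
    ext ω; simp only [Set.mem_inter_iff]; tauto
  have e6 : prob p ((L ∩ O)ᶜ ∩ Bvᶜ ∩ L) = prob p (L ∩ Bvᶜ) - prob p (L ∩ Bvᶜ) * prob p O := by
    rw [← hLBO, ← prob_inter_compl_eq]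
    congr 1
    ext ω; simp only [Set.mem_inter_iff, Set.mem_compl_iff]; tauto
  rw [e1, e2, e4, e5, e6]
  rw [e3] at hH ⊢
  nlinarith [mul_nonneg ho0 (sub_nonneg.2 hH)]

omit [Fintype V] in
/-- **(★₂′) when `o` is a cut vertex separating `a₁`, `v` from `b`.**  With `o = P_A(a₁ ↔ o)`,
`ℓ = P_A(a₁ ↔ v)`, `c = P_A(a₁ ↔ o, a₁ ↔ v)`, `β = P_B(o ↔ b)`:
`RHS − LHS = β·[c(1 − o) + o(ℓ − c)] ≥ 0` (no correlation input). -/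
theorem vMarkedVdBK_of_cut_o_near {p : E → R} (hp : IsProbVec p) (h : IsCut ends x VA VB EA EB)
    {a₁ v b : V} (ha : a₁ ∈ VA) (hv : v ∈ VA) (hb : b ∈ VB) : VMarkedVdBK p ends a₁ v x b := by
  unfold VMarkedVdBK
  have eL : connEvent ends a₁ v = sideEvent EA (connEvent ends a₁ v) :=
    connEvent_eq_sideEvent h (Set.mem_union_left _ ha) (Set.mem_union_left _ hv)
  have eo : connEvent ends a₁ x = sideEvent EA (connEvent ends a₁ x) :=
    connEvent_eq_sideEvent h (Set.mem_union_left _ ha) (Set.mem_union_right _ (Set.mem_singleton x))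
  have eb : connEvent ends a₁ b =
      sideEvent EA (connEvent ends a₁ x) ∩ sideEvent EB (connEvent ends x b) :=
    connEvent_across_eq h ha hb
  rw [avoidAll_pair, avoidAll_singleton, avoidAll_singleton, eL, eo, eb]
  set L := sideEvent EA (connEvent ends a₁ v) with hL
  set O := sideEvent EA (connEvent ends a₁ x) with hO
  set B := sideEvent EB (connEvent ends x b) with hB
  have hOB : prob p (O ∩ B) = prob p O * prob p B := prob_sideEvent_inter_eq_mul p h _ _
  have hOLB : prob p ((O ∩ L) ∩ B) = prob p (O ∩ L) * prob p B := by
    rw [hO, hL, ← sideEvent_inter]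
    exact prob_sideEvent_inter_eq_mul p h _ _
  have hc : prob p (O ∩ L) ≤ prob p L := prob_inter_le_right hp O L
  have hc0 := prob_nonneg hp (O ∩ L)
  have ho1 := prob_le_one hp O
  have ho0 := prob_nonneg hp O
  have hb0 := prob_nonneg hp B
  have e1 : prob p Oᶜ = 1 - prob p O := prob_compl p O
  have e2 : prob p ((O ∩ B)ᶜ ∩ L) = prob p L - prob p (O ∩ L) * prob p B := by
    rw [Set.inter_comm, prob_inter_compl_eq, ← hOLB]
    congr 2
    ext ω; simp only [Set.mem_inter_iff]; tauto
  have e3 : prob p (O ∩ B)ᶜ = 1 - prob p O * prob p B := by rw [prob_compl, hOB]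
  have e4 : prob p (Oᶜ ∩ L) = prob p L - prob p (O ∩ L) := by
    rw [Set.inter_comm, prob_inter_compl_eq, Set.inter_comm]
  have e5 : prob p (Oᶜ ∩ (O ∩ B)ᶜ) = 1 - prob p O := by
    rw [← prob_compl]
    congr 1
    ext ω; simp only [Set.mem_inter_iff, Set.mem_compl_iff]; tauto
  have e6 : prob p (Oᶜ ∩ (O ∩ B)ᶜ ∩ L) = prob p L - prob p (O ∩ L) := by
    rw [← e4]
    congr 1
    ext ω; simp only [Set.mem_inter_iff, Set.mem_compl_iff]; tauto
  rw [e1, e2, e3, e4, e5, e6]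
  nlinarith [mul_nonneg hb0 (mul_nonneg hc0 (sub_nonneg.2 ho1)),
    mul_nonneg hb0 (mul_nonneg ho0 (sub_nonneg.2 hc))]

omit [Fintype V] in
/-- **(★₂′) when `o` is a cut vertex separating `a₁` from `v`, `b`.**  With `o = P_A(a₁ ↔ o)`,
`ℓ' = P_B(o ↔ v)`, `n' = P_B(o ↔ v, o ↮ b)`: `RHS − LHS = o(1 − o)(ℓ' − n') ≥ 0`. -/
theorem vMarkedVdBK_of_cut_o_far {p : E → R} (hp : IsProbVec p) (h : IsCut ends x VA VB EA EB)
    {a₁ v b : V} (ha : a₁ ∈ VA) (hv : v ∈ VB) (hb : b ∈ VB) : VMarkedVdBK p ends a₁ v x b := by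
  unfold VMarkedVdBK
  have eL : connEvent ends a₁ v =
      sideEvent EA (connEvent ends a₁ x) ∩ sideEvent EB (connEvent ends x v) :=
    connEvent_across_eq h ha hv
  have eo : connEvent ends a₁ x = sideEvent EA (connEvent ends a₁ x) :=
    connEvent_eq_sideEvent h (Set.mem_union_left _ ha) (Set.mem_union_right _ (Set.mem_singleton x))
  have eb : connEvent ends a₁ b =
      sideEvent EA (connEvent ends a₁ x) ∩ sideEvent EB (connEvent ends x b) :=
    connEvent_across_eq h ha hb
  rw [avoidAll_pair, avoidAll_singleton, avoidAll_singleton, eo, eL, eb]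
  set O := sideEvent EA (connEvent ends a₁ x) with hO
  set L' := sideEvent EB (connEvent ends x v) with hL'
  set B := sideEvent EB (connEvent ends x b) with hB
  have hOL : prob p (O ∩ L') = prob p O * prob p L' := prob_sideEvent_inter_eq_mul p h _ _
  have hOB : prob p (O ∩ B) = prob p O * prob p B := prob_sideEvent_inter_eq_mul p h _ _
  have hOLB : prob p (O ∩ (L' ∩ Bᶜ)) = prob p O * prob p (L' ∩ Bᶜ) := by
    rw [hL', hB, ← sideEvent_compl, ← sideEvent_inter]
    exact prob_sideEvent_inter_eq_mul p h _ _
  have hn : prob p (L' ∩ Bᶜ) ≤ prob p L' := prob_inter_le_left hp L' Bᶜ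
  have ho1 := prob_le_one hp O
  have ho0 := prob_nonneg hp O
  have e1 : prob p Oᶜ = 1 - prob p O := prob_compl p O
  have e2 : prob p ((O ∩ B)ᶜ ∩ (O ∩ L')) = prob p O * prob p (L' ∩ Bᶜ) := by
    rw [← hOLB]
    congr 1
    ext ω; simp only [Set.mem_inter_iff, Set.mem_compl_iff]; tauto
  have e3 : prob p (O ∩ B)ᶜ = 1 - prob p O * prob p B := by rw [prob_compl, hOB]
  have e4 : prob p (Oᶜ ∩ (O ∩ L')) = 0 := by
    rw [← prob_empty p]
    congr 1
    ext ω; simp only [Set.mem_inter_iff, Set.mem_compl_iff, Set.mem_empty_iff_false]; tauto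
  have e5 : prob p (Oᶜ ∩ (O ∩ B)ᶜ) = 1 - prob p O := by
    rw [← prob_compl]
    congr 1
    ext ω; simp only [Set.mem_inter_iff, Set.mem_compl_iff]; tauto
  have e6 : prob p (Oᶜ ∩ (O ∩ B)ᶜ ∩ (O ∩ L')) = 0 := by
    rw [← prob_empty p]
    congr 1
    ext ω; simp only [Set.mem_inter_iff, Set.mem_compl_iff, Set.mem_empty_iff_false]; tauto
  rw [e1, e2, e3, e4, e5, e6, hOL]
  nlinarith [mul_nonneg (mul_nonneg ho0 (sub_nonneg.2 ho1)) (sub_nonneg.2 hn)]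

omit [Fintype V] in
/-- **(★₂′) when `o` is a cut vertex separating `a₁`, `b` from `v`.**  With `o = P_A(a₁ ↔ o)`,
`R_b` read on the `A`-side, `ℓ' = P_B(o ↔ v)`:
`RHS − LHS = ℓ'·[P_A(a₁ ↔ o)·P_A(R_b) − P_A(a₁ ↔ o, R_b)] ≥ 0` (Harris, mixed form). -/
theorem vMarkedVdBK_of_cut_o_mid {p : E → R} (hp : IsProbVec p) (h : IsCut ends x VA VB EA EB)
    {a₁ v b : V} (ha : a₁ ∈ VA) (hv : v ∈ VB) (hb : b ∈ VA) : VMarkedVdBK p ends a₁ v x b := by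
  unfold VMarkedVdBK
  have eL : connEvent ends a₁ v =
      sideEvent EA (connEvent ends a₁ x) ∩ sideEvent EB (connEvent ends x v) :=
    connEvent_across_eq h ha hv
  have eo : connEvent ends a₁ x = sideEvent EA (connEvent ends a₁ x) :=
    connEvent_eq_sideEvent h (Set.mem_union_left _ ha) (Set.mem_union_right _ (Set.mem_singleton x))
  have eb : connEvent ends a₁ b = sideEvent EA (connEvent ends a₁ b) :=
    connEvent_eq_sideEvent h (Set.mem_union_left _ ha) (Set.mem_union_left _ hb)
  rw [avoidAll_pair, avoidAll_singleton, avoidAll_singleton, eo, eL, eb]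
  set O := sideEvent EA (connEvent ends a₁ x) with hO
  set L' := sideEvent EB (connEvent ends x v) with hL'
  set Bv := sideEvent EA (connEvent ends a₁ b) with hBv
  have hOL : prob p (O ∩ L') = prob p O * prob p L' := prob_sideEvent_inter_eq_mul p h _ _
  have hOBL : prob p ((O ∩ Bvᶜ) ∩ L') = prob p (O ∩ Bvᶜ) * prob p L' := by
    rw [hO, hBv, ← sideEvent_compl, ← sideEvent_inter]
    exact prob_sideEvent_inter_eq_mul p h _ _
  -- Harris, mixed form, on the `A`-side
  have hH : prob p (O ∩ Bvᶜ) ≤ prob p O * prob p Bvᶜ := by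
    rw [Set.inter_comm, mul_comm]
    exact prob_inter_le_prob_mul_prob_of_isLowerSet hp
      (isUpperSet_sideEvent_cm EA (isUpperSet_connEvent ends a₁ b)).compl
      (isUpperSet_sideEvent_cm EA (isUpperSet_connEvent ends a₁ x))
  have hl0 := prob_nonneg hp L'
  have e1 : prob p Oᶜ = 1 - prob p O := prob_compl p O
  have e2 : prob p (Bvᶜ ∩ (O ∩ L')) = prob p (O ∩ Bvᶜ) * prob p L' := by
    rw [← hOBL]
    congr 1
    ext ω; simp only [Set.mem_inter_iff, Set.mem_compl_iff]; tauto
  have e3 : prob p Bvᶜ = 1 - prob p Bv := prob_compl p Bv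
  have e4 : prob p (Oᶜ ∩ (O ∩ L')) = 0 := by
    rw [← prob_empty p]
    congr 1
    ext ω; simp only [Set.mem_inter_iff, Set.mem_compl_iff, Set.mem_empty_iff_false]; tauto
  have e5 : prob p (Oᶜ ∩ Bvᶜ) = prob p Bvᶜ - prob p (O ∩ Bvᶜ) := by
    rw [Set.inter_comm, prob_inter_compl_eq, Set.inter_comm]
  have e6 : prob p (Oᶜ ∩ Bvᶜ ∩ (O ∩ L')) = 0 := by
    rw [← prob_empty p]
    congr 1
    ext ω; simp only [Set.mem_inter_iff, Set.mem_compl_iff, Set.mem_empty_iff_false]; tauto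
  rw [e1, e2, e4, e5, e6, hOL]
  rw [e3] at hH ⊢
  nlinarith [mul_nonneg hl0 (sub_nonneg.2 hH)]

omit [Fintype V] in
/-- **(★₂′) when the root `a₁` is a cut vertex separating `v` from `o`, `b`** (the placement not
covered by `CrossAPrimeVMarkedCut.lean`).  With `ℓ = P_A(a₁ ↔ v)`:
`RHS − LHS = 2ℓ·[P_B(R_{o,b}) − P_B(R_o)·P_B(R_b)] ≥ 0` (Harris for decreasing events). -/
theorem vMarkedVdBK_of_cut_root_v {p : E → R} (hp : IsProbVec p) (h : IsCut ends x VA VB EA EB)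
    {v o b : V} (hv : v ∈ VA) (ho : o ∈ VB) (hb : b ∈ VB) : VMarkedVdBK p ends x v o b := by
  unfold VMarkedVdBK
  have eL : connEvent ends x v = sideEvent EA (connEvent ends x v) :=
    connEvent_eq_sideEvent h (Set.mem_union_right _ (Set.mem_singleton x)) (Set.mem_union_left _ hv)
  have eo : connEvent ends x o = sideEvent EB (connEvent ends x o) :=
    connEvent_eq_sideEvent h.symm (Set.mem_union_right _ (Set.mem_singleton x))
      (Set.mem_union_left _ ho)
  have eb : connEvent ends x b = sideEvent EB (connEvent ends x b) :=
    connEvent_eq_sideEvent h.symm (Set.mem_union_right _ (Set.mem_singleton x))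
      (Set.mem_union_left _ hb)
  rw [avoidAll_pair, avoidAll_singleton, avoidAll_singleton, eL, eo, eb]
  set L := sideEvent EA (connEvent ends x v) with hL
  set O := sideEvent EB (connEvent ends x o) with hO
  set B := sideEvent EB (connEvent ends x b) with hB
  have hOL : prob p (Oᶜ ∩ L) = prob p Oᶜ * prob p L := by
    rw [Set.inter_comm, mul_comm, hO, ← sideEvent_compl]
    exact prob_sideEvent_inter_eq_mul p h _ _
  have hBL : prob p (Bᶜ ∩ L) = prob p Bᶜ * prob p L := by
    rw [Set.inter_comm, mul_comm, hB, ← sideEvent_compl]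
    exact prob_sideEvent_inter_eq_mul p h _ _
  have hOBL : prob p (Oᶜ ∩ Bᶜ ∩ L) = prob p (Oᶜ ∩ Bᶜ) * prob p L := by
    rw [Set.inter_comm, mul_comm, hO, hB, ← sideEvent_compl, ← sideEvent_compl, ← sideEvent_inter]
    exact prob_sideEvent_inter_eq_mul p h _ _
  -- Harris for the two decreasing `B`-side events
  have hH : prob p Oᶜ * prob p Bᶜ ≤ prob p (Oᶜ ∩ Bᶜ) :=
    prob_mul_prob_le_prob_inter_of_isLowerSet hp
      (isUpperSet_sideEvent_cm EB (isUpperSet_connEvent ends x o)).compl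
      (isUpperSet_sideEvent_cm EB (isUpperSet_connEvent ends x b)).compl
  have hl0 := prob_nonneg hp L
  rw [hOL, hBL, hOBL]
  nlinarith [mul_nonneg hl0 (sub_nonneg.2 hH)]

/-! ### Mirrors: `b` as the cut vertex, and the second `v`-placement (the `o ↔ b` symmetry) -/

omit [Fintype V] in
/-- `b` a cut vertex separating `a₁`, `v` from `o`. -/
theorem vMarkedVdBK_of_cut_b_near {p : E → R} (hp : IsProbVec p) (h : IsCut ends x VA VB EA EB)
    {a₁ v o : V} (ha : a₁ ∈ VA) (hv : v ∈ VA) (ho : o ∈ VB) : VMarkedVdBK p ends a₁ v o x :=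
  (vMarkedVdBK_comm p ends a₁ v o x).2 (vMarkedVdBK_of_cut_o_near hp h ha hv ho)

omit [Fintype V] in
/-- `b` a cut vertex separating `a₁` from `v`, `o`. -/
theorem vMarkedVdBK_of_cut_b_far {p : E → R} (hp : IsProbVec p) (h : IsCut ends x VA VB EA EB)
    {a₁ v o : V} (ha : a₁ ∈ VA) (hv : v ∈ VB) (ho : o ∈ VB) : VMarkedVdBK p ends a₁ v o x :=
  (vMarkedVdBK_comm p ends a₁ v o x).2 (vMarkedVdBK_of_cut_o_far hp h ha hv ho)

omit [Fintype V] in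
/-- `b` a cut vertex separating `a₁`, `o` from `v`. -/
theorem vMarkedVdBK_of_cut_b_mid {p : E → R} (hp : IsProbVec p) (h : IsCut ends x VA VB EA EB)
    {a₁ v o : V} (ha : a₁ ∈ VA) (hv : v ∈ VB) (ho : o ∈ VA) : VMarkedVdBK p ends a₁ v o x :=
  (vMarkedVdBK_comm p ends a₁ v o x).2 (vMarkedVdBK_of_cut_o_mid hp h ha hv ho)

omit [Fintype V] in
/-- `v` a cut vertex, `a₁`, `o` on one side, `b` on the other (the mirror of `_v_near`). -/
theorem vMarkedVdBK_of_cut_v_near' {p : E → R} (hp : IsProbVec p) (h : IsCut ends x VA VB EA EB)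
    {a₁ o b : V} (ha : a₁ ∈ VA) (ho : o ∈ VA) (hb : b ∈ VB) : VMarkedVdBK p ends a₁ x o b :=
  (vMarkedVdBK_comm p ends a₁ x o b).2 (vMarkedVdBK_of_cut_v_near hp h ha hb ho)

end CutV

end CrossAPrimeVMarkedCutMark

end Summit.Ventures.PercRepro2
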